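import Summits.BirchSwinnertonDyer.Rank1Residual.Additive.TameBranchAnalyticShaRankZero
import HarnessLib

/-!
# `BSD(E,p)` ⟺ THE MAIN CONJECTURE AT THE PAIR (rank 0, defect 2, big image) — the upper half
# `ord_p #Ш[p^∞] + ord_p ℓ_p ≤ ord_p #Ш_an` holds on every row, with EQUALITY iff the Kato element
# GENERATES `char_Λ X(E/ℚ_∞)`; so Miller's `BSD(E,p)` ⟹ Delbourgo's main conjecture at the pair
# (integrally, E-normalised) and `ℓ_p = 1`, and conversely off the anomalous rows
# (cell `b2b-bsdres`, sub-cell additive-p2 = X3♯(G-ord)/X4♯(G-ord), gen 32; part 6)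

HONEST FRAMING (cell `b2b-bsdres`, run/shared/lean/b2b/bsd-rank1-residual/, verbatim in every
file): the goal of the cell is to DELETE the COMBINATION-SHAPED residual classes of the
Birch–Swinnerton-Dyer formula for ALL analytic-rank `≤ 1` elliptic curves over `ℚ` — "full BSD
formula for every rank `≤ 1` curve in class `C`" assembled STRICTLY from published theorems — so
that the rank-`≤ 1` remainder becomes exactly the CONSTRUCTION-SHAPED classes, which are TYPED
(missing-input `Prop`s), NOT attempted. This is not "finishing BSD". Sub-cell additive-p2: the
classes X3♯(G-ord) / X4♯(G-ord) are CONSTRUCTION-SHAPED and stay so; labels / RESIDUAL-MAP marks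
UNCHANGED; nothing is booked (`BSD(E,p)` enters ONLY as a HYPOTHESIS in §2). Theorems only; published
inputs are explicit binders (`hK` Kato 2004 Thm. 17.4 (3), `hDel` = A175, `hGZK`, `hmod`,
`LeadingTermClauses W p Dh` = Delbourgo 2002 (B) for a datum). No definition, no named fact, no `sorry`.

## What and why

Parts 1–5 of gen 32: `p ∤ #Ш_an(E)` certifies the main conjecture at a rank-0 defect-2 pair. Where `p ∣ #Ш_an(E)`
(census: 2900d1, 10850m1, 16900k1, 19350cb1 at `p = 5`, `#Ш_an = 25`) the squeeze cannot fire; THIS FILE says what is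
then at stake. §1 (per cyclotomic datum, series-agnostic): for ANY `g ∈ char_Λ X` with `ι g = X`, `X(0) ≠ 0`, Delbourgo's
`ℓ ∣ p²` has **`ord_p #Ш[p^∞] + ord_p ∏c + ord_p ℓ ≤ v_p(X(0)) + 2·ord_p #tors`, EQUALITY iff `char_Λ X = (g)`** (gen 29's
inequality + Greenberg–Vatsal's `(g') = (g) ⟺ μ, λ agree` on part 1's `μ`-decomposition). §2 (X4♯(G-ord, `e = 2`) ∩ `I₀*` ∩
{`ρ̄` onto}, `p ≥ 5`, non-CM, `r_an = 0`; part 1's dictionary): for every twist datum and cyclotomic datum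
**`ord_p #Ш(E/ℚ)[p^∞] + ord_p ℓ ≤ ord_p #Ш_an(E)`, EQUALITY ⟺ `char_Λ X = (Kato element)`**
(`ClassX4Gord.padicVal_sha_add_le_shaAn_and_iff_rankZero`); hence **`BSD(E,p)` ⟹ the main conjecture at the pair (integrally)
AND `ℓ = 1`** (`…charIdeal_eq_span_kato_of_bsdp_rankZero`); conversely off the anomalous rows **MC(pair) ⟹ `BSD(E,p)`**
(`…bsdp_of_charIdeal_eq_span_kato_rankZero`); and **a LOWER bound `ord_p #Ш_an ≤ ord_p #Ш[p^∞]` (a `p`-descent / visibility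
certificate; no Euler system supplies it) ⟹ `BSD(E,p)` + MC(pair) + `ℓ = 1`** (`…of_shaAn_le_card_rankZero`) — the exact residual on
the `25 ∣ #Ш_an` rows. So on these rows `BSD(E,p)` and Delbourgo's main conjecture (G) at the pair are ONE statement up to `ℓ_p`.
Nothing booked; labels UNCHANGED.

References: Kato 2004 Thm. 17.4 (3) [Kato2004Asterisque]; Delbourgo 2002 Thm. (A), (B) p. 40 [Delbourgo2002];
Greenberg–Vatsal 2000 p. 4 [GreenbergVatsal2000]; Greenberg LNM 1716 §4 [GreenbergLNM1716]; Washington GTM 83 §7.1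
[Washington1997]; Miller 2011 Def. 1.1 [Miller2011LMS]; gen 29 `TameBranchExtraZerosRankZero`, gen 32 parts 1–2. -/

set_option autoImplicit false

noncomputable section

open scoped Classical MatrixGroups ModularForm NumberField

open CongruenceSubgroup IsDedekindDomain WeierstrassCurve NumberField
  Literature.NumberTheory.EllipticCurves
  Literature.NumberTheory.EllipticCurves.ModularForms
  Literature.NumberTheory.EllipticCurves.Rank1Residual
  Literature.NumberTheory.EllipticCurves.Rank1Residual.Typed
  Literature.NumberTheory.EllipticCurves.Delbourgo2002
  Literature.NumberTheory.GaloisRepresentations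
  Summit.BirchSwinnertonDyer.Rank1Residual.AdditivePotMult
  Summit.BirchSwinnertonDyer.Rank1Residual.X1.MuLambda
  Summit.BirchSwinnertonDyer.Rank1Residual.X1.RankOneParitySqueeze
  Summit.BirchSwinnertonDyer.Rank1Residual.X11a.LambdaNorm

namespace Summit.BirchSwinnertonDyer.Rank1Residual.Additive

/-! ### §1 Per datum: the upper half at `T = 0`, EQUALITY iff the Kato element generates -/

namespace TameBranchAnalyticSha

open TameBranchExtraZeros

variable {W : WeierstrassCurve ℚ} [W.IsElliptic] {p : ℕ} [hp : Fact p.Prime]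

/-- **Per datum (rank 0): `ord_p #Ш[p^∞] + ord_p ∏c + ord_p ℓ ≤ v_p(X(0)) + 2·ord_p #tors`, EQUALITY
iff `char_Λ X = (g)`.** `rank_ℤ E(ℚ) = 0`, a (B)-datum, a cyclotomic dual datum with `X` torsion and
generator `fE`, ANY `g ∈ char_Λ X` with `ι g = X`, `X(0) ≠ 0`. Delbourgo's clause 3 supplies `ℓ ∣ p²`
(`= 1` off the anomalous rows); gen 29's inequality on `B := ι(pfree g)` and Greenberg–Vatsal's
"`(g') = (g) ⟺ μ, λ agree`" give the equivalence. [cite: Delbourgo2002, Theorem (B) (p. 40)]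
[cite: GreenbergVatsal2000, p. 4 (after Thm. (1.2))] [cite: Washington1997, §7.1] -/
theorem charIdeal_eq_span_iff_valuation_eq_rankZero_of_iota_eq
    (hr0 : W.mordellWeilRank = 0) {Dh : PAdicHeightData W p} (hBcl : LeadingTermClauses W p Dh)
    {κ : ZpExtension ℚ p} {γ : Field.absoluteGaloisGroup ℚ}
    (hκ : κ.IsCyclotomic) (hγ : κ.IsTopGenerator γ) (hγ' : IsCyclotomicVariable p γ)
    (D : W.SelmerDualData κ γ) [Module.Finite (IwasawaAlgebra p) D.X] (hX : D.IsTorsion)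
    {fE g : IwasawaAlgebra p} (hchar : D.charIdeal = Ideal.span {fE}) (hg : g ∈ D.charIdeal)
    {X : PowerSeries ℚ_[p]} (hι : iwasawaToPowerSeries p g = X)
    (hX0 : PowerSeries.constantCoeff X ≠ 0) :
    Finite (AddCommGroup.primaryComponent W.sha p) ∧
      ∃ ℓ : ℕ, ℓ ∣ p ^ 2 ∧ (ReductionNonAnomalous W p → ℓ = 1) ∧
        (padicValNat p (Nat.card (AddCommGroup.primaryComponent W.sha p)) : ℤ) +
            padicValNat p W.tamagawaProduct + padicValNat p ℓ ≤
          (PowerSeries.constantCoeff X).valuation + 2 * padicValNat p W.torsionOrder ∧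
        (D.charIdeal = Ideal.span {g} ↔
          (padicValNat p (Nat.card (AddCommGroup.primaryComponent W.sha p)) : ℤ) +
              padicValNat p W.tamagawaProduct + padicValNat p ℓ =
            (PowerSeries.constantCoeff X).valuation + 2 * padicValNat p W.torsionOrder) := by
  have hg0 : g ≠ 0 := by intro h0; apply hX0; rw [← hι, h0, map_zero, map_zero]
  have hιB := iota_eq_C_pow_mu_mul_iota_pfree (p := p) g
  have hbd := norm_coeff_iota_pfree_le (p := p) g
  obtain ⟨hn, hlt⟩ := firstTop_iota_pfree (p := p) hg0
  obtain ⟨hB0, hvX⟩ := valuation_coeff_iota_eq_mu_add hι (j := 0) (by rwa [PowerSeries.coeff_zero_eq_constantCoeff])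
  rw [PowerSeries.coeff_zero_eq_constantCoeff] at hB0 hvX
  -- the factorisation `g = fE · h`
  have hg' := hg
  rw [hchar] at hg'
  obtain ⟨h, hh⟩ := Ideal.mem_span_singleton'.mp hg'
  have hfac : g = fE * h := by rw [← hh, mul_comm]
  have hfE0 : fE ≠ 0 := by intro e; apply hg0; rw [hfac, e, zero_mul]
  have hμle : mu fE ≤ mu g := mu_le_mu_of_mem_span hg' hg0
  obtain ⟨-, hfin, ℓ, hℓp, hℓ1, hle, hrest⟩ :=
    schneider_and_padicVal_le_rankZero_of_iota_eq hr0 hBcl hκ hγ hγ' D hX hchar hg hιB hbd hB0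
  obtain ⟨-, hiff⟩ := hrest (lam g) hn hlt
  haveI : Finite W.toAffine.Point := W.mordellWeilRank_eq_zero_iff_finite.mp hr0
  have hReg : (padicRegulator Dh).valuation = 0 := by
    rw [padicRegulator_eq_one_of_finite W p Dh, Padic.valuation_one]
  rw [hReg] at hle hiff
  simp only [Nat.cast_zero, add_zero] at hle hiff
  have hμle' : (mu fE : ℤ) ≤ mu g := by exact_mod_cast hμle
  refine ⟨hfin, ℓ, hℓp, hℓ1, by rw [hvX]; linarith, ?_⟩
  rw [hvX, hchar]
  constructor
  · -- `(fE) = (g)` ⟹ `μ, λ` agree ⟹ equality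
    intro hspan
    obtain ⟨hμ, hlam⟩ := (span_eq_span_iff_mu_lam hfE0 hg0 hfac).mp hspan.symm
    have e := hiff.mpr hlam.symm
    rw [hμ]
    exact e
  · -- equality ⟹ `μ(fE) = μ(g)` (the chain is tight) and `λ(fE) = λ(g)` (gen 29's criterion)
    intro heq
    have hμeq : (mu fE : ℤ) = mu g := by linarith
    have hlam : lam fE = lam g := hiff.mp (by linarith)
    have hμeq' : mu fE = mu g := by exact_mod_cast hμeq
    exact ((span_eq_span_iff_mu_lam hfE0 hg0 hfac).mpr ⟨hμeq'.symm, hlam.symm⟩).symm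

end TameBranchAnalyticSha

/-! ### §2 X4♯(G-ord, `e = 2`) ∩ `I₀*` ∩ {`ρ̄` onto}, rank 0: `BSD(E,p)` versus the main conjecture at the pair -/

section ClassLevel

open TameBranchMuPart TameBranchAnalyticSha

variable {W : WeierstrassCurve ℚ} [W.IsElliptic] [W.IsGloballyMinimal] {p : ℕ} [hp : Fact p.Prime]

/-- **THE UPPER HALF WITH `ℓ`, AND ITS EQUALITY CASE.** X4♯(G-ord) ∩ `I₀*` ∩ {`ρ̄_{E,p}` onto}, `p ≥ 5`,
`E` non-CM, `ord_{s=1} L(E,s) = 0`, `#Ш_an(E) = s ∈ ℚ`; twist data `(V, C, f, ϖ)` (`V = E♭` good ordinary,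
`C • V^{(p*)} = W`, `f` newform of `V`, `ϖ` period ratio). Then there is a (B)-datum (A175) such that for
every cyclotomic dual datum there are the Kato element `g ∈ char_Λ X` (`ι g = u·ϖ·B^±_{(p−1)/2}(f, α)`,
`v_p(g(0)) + 2·ord_p #tors = ord_p s + ord_p ∏c`) and Delbourgo's `ℓ ∣ p²` (`= 1` off the anomalous rows)
with **`ord_p #Ш(E/ℚ)[p^∞] + ord_p ℓ ≤ ord_p s`, EQUALITY ⟺ `char_Λ X = (g)`**. [cite: Kato2004Asterisque, Thm. 17.4 (3) (p. 273)]
[cite: Delbourgo2002, Theorem (A), (B) (p. 40)] [cite: GreenbergVatsal2000, p. 4] [cite: Miller2011LMS, §1 (arXiv:1010.2431 p. 3)] -/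
theorem ClassX4Gord.padicVal_sha_add_le_shaAn_and_iff_rankZero
    (hK : Wuthrich2014.kato_halfEigenCharIdeal_dvd_cyclotomicPrime_of_surjective)
    (hDel : Delbourgo2002.mainTheorem) (hGZK : rank_eq_analyticRank_of_analyticRank_le_one)
    (hmod : hasEntireLFunction_rat)
    (hX : ClassX4Gord W p) (hp5 : 5 ≤ p) (hcm : ¬ W.HasCM) (hsurj : Surj W p)
    (hr : W.analyticRank = 0) {s : ℚ} (hs : shaAn W = (s : ℂ))
    (V : WeierstrassCurve ℚ) [V.IsElliptic] [V.IsGloballyMinimal] (C : VariableChange ℚ)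
    (hC : C • V.quadraticTwist ((-1 : ℚ) ^ (p / 2) * p) = W) (hV : GoodOrd V p)
    {N : ℕ} [NeZero N] {f : CuspForm (Gamma0 N) 2} (hf : IsNewformOf V f)
    (ϖ : ℚ) (hϖ : if Even (p / 2) then (ϖ : ℝ) * V.realPeriodRat = plusPeriod f
      else (ϖ : ℝ) * V.imaginaryPeriodRat = minusPeriod f) :
    ∃ Dh : PAdicHeightData W p, LeadingTermClauses W p Dh ∧
      ∀ (κ : ZpExtension ℚ p) (γ : Field.absoluteGaloisGroup ℚ),
        κ.IsCyclotomic → κ.IsTopGenerator γ → IsCyclotomicVariable p γ → ∀ D : W.SelmerDualData κ γ,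
        D.IsTorsion ∧ Finite (AddCommGroup.primaryComponent W.sha p) ∧
        ∃ (g : IwasawaAlgebra p) (u : ℤ_[p]ˣ) (ℓ : ℕ), g ∈ D.charIdeal ∧
          iwasawaToPowerSeries p g = PowerSeries.C (((u : ℤ_[p]) : ℚ_[p]) * (ϖ : ℚ_[p])) *
            (if Even (p / 2) then padicLFunctionBranch f ((unitRoot V p : ℤ_[p]) : ℚ_[p]) (p / 2)
              else padicLFunctionMinusBranch f ((unitRoot V p : ℤ_[p]) : ℚ_[p]) (p / 2)) ∧
          (((PowerSeries.constantCoeff g : ℤ_[p]) : ℚ_[p])).valuation + 2 * padicValNat p W.torsionOrder =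
            padicValRat p s + padicValNat p W.tamagawaProduct ∧
          ℓ ∣ p ^ 2 ∧ (ReductionNonAnomalous W p → ℓ = 1) ∧
          (padicValNat p (Nat.card (AddCommGroup.primaryComponent W.sha p)) : ℤ) + padicValNat p ℓ ≤
            padicValRat p s ∧
          (D.charIdeal = Ideal.span {g} ↔
            (padicValNat p (Nat.card (AddCommGroup.primaryComponent W.sha p)) : ℤ) + padicValNat p ℓ =
              padicValRat p s) := by
  have hp2 : p ≠ 2 := by omega
  have hadd : Addv W p := hX.addv.2
  obtain ⟨hmw, -⟩ := hGZK W (by rw [hr]; norm_num)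
  have hr0 : W.mordellWeilRank = 0 := by rw [hmw, hr]
  have hL : W.entireLFunction 1 ≠ 0 := (W.analyticRank_eq_zero_iff_holds (hmod W)).mp hr
  have hΩ : (W.realPeriodRat : ℂ) ≠ 0 := by exact_mod_cast W.realPeriodRat_pos_holds.ne'
  obtain ⟨Dh, hBcl⟩ := Delbourgo2002.mainTheorem.exists_leadingTermClauses hDel hp5 hcm hadd hX.typeGOrd
  have hj := padicValRat_j_nonneg_of_typeGOrd W p hX.typeGOrd
  have hsurjV : ∀ m : ℕ, V.HasSurjectiveModNGaloisRep (p ^ m : ℕ) :=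
    X4RankZeroTwistOdd.forall_surj_pow_twist_of_surj W p hp5 V (pStar_ne_zero p) C hC hsurj
  have hord : IsOrdinaryAt V p :=
    isOrdinaryAt_of_goodOrd_or_mult_of_model_twist W V (pStar_ne_zero p) ⟨C, hC⟩ hj (Or.inl hV)
  -- the dictionary at `T = 0`
  obtain ⟨q, u', hu'0, -, hLq, hA⟩ :=
    exists_rat_and_unit_constantCoeff_branch_eq hmod hp2 hadd V C hC hord hf ϖ hϖ
  have hdict :=
    valuation_constantCoeff_branch_add_eq_padicValRat_shaAn_add hmod hGZK hp2 hadd hL V C hC hord hf ϖ hϖ hs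
  have hq0 : q ≠ 0 := by
    intro h0; apply hL
    have e : W.entireLFunction 1 = (q : ℂ) * (W.realPeriodRat : ℂ) := by rw [← hLq, div_mul_cancel₀ _ hΩ]
    rw [e, h0, Rat.cast_zero, zero_mul]
  have hϖB0 : PowerSeries.constantCoeff (PowerSeries.C (ϖ : ℚ_[p]) *
      (if Even (p / 2) then padicLFunctionBranch f ((unitRoot V p : ℤ_[p]) : ℚ_[p]) (p / 2)
        else padicLFunctionMinusBranch f ((unitRoot V p : ℤ_[p]) : ℚ_[p]) (p / 2))) ≠ 0 := by
    rw [hA]; exact mul_ne_zero hu'0 (by exact_mod_cast hq0)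
  refine ⟨Dh, hBcl, fun κ γ hκ hγ hγ' D ↦ ?_⟩
  haveI : Module.Finite (IwasawaAlgebra p) D.X :=
    SelmerDualData.module_finite_of_isCyclotomic (W := W) (κ := κ) hκ D hγ
  obtain ⟨hXt, g, hg, u, hι⟩ := isTorsion_and_exists_iota_eq_branch_of_katoComponent W p
    (Kato2004.charIdeal_dvd_padicLFunctionBranch_component_of_surjective_of_half hK) hj hp2 V
    ⟨C, hC⟩ (Or.inl hV) hsurjV hκ hγ hγ' hf D ϖ hϖ
  have hX0eq : PowerSeries.constantCoeff (PowerSeries.C (((u : ℤ_[p]) : ℚ_[p]) * (ϖ : ℚ_[p])) *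
      (if Even (p / 2) then padicLFunctionBranch f ((unitRoot V p : ℤ_[p]) : ℚ_[p]) (p / 2)
        else padicLFunctionMinusBranch f ((unitRoot V p : ℤ_[p]) : ℚ_[p]) (p / 2))) =
      ((u : ℤ_[p]) : ℚ_[p]) * PowerSeries.constantCoeff (PowerSeries.C (ϖ : ℚ_[p]) *
        (if Even (p / 2) then padicLFunctionBranch f ((unitRoot V p : ℤ_[p]) : ℚ_[p]) (p / 2)
          else padicLFunctionMinusBranch f ((unitRoot V p : ℤ_[p]) : ℚ_[p]) (p / 2))) := by
    simp only [map_mul, PowerSeries.constantCoeff_C]; ring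
  have hX0 : PowerSeries.constantCoeff (PowerSeries.C (((u : ℤ_[p]) : ℚ_[p]) * (ϖ : ℚ_[p])) *
      (if Even (p / 2) then padicLFunctionBranch f ((unitRoot V p : ℤ_[p]) : ℚ_[p]) (p / 2)
        else padicLFunctionMinusBranch f ((unitRoot V p : ℤ_[p]) : ℚ_[p]) (p / 2))) ≠ 0 := by
    rw [hX0eq]; exact mul_ne_zero (coe_units_ne_zero p u) hϖB0
  have hvX : (PowerSeries.constantCoeff (PowerSeries.C (((u : ℤ_[p]) : ℚ_[p]) * (ϖ : ℚ_[p])) *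
      (if Even (p / 2) then padicLFunctionBranch f ((unitRoot V p : ℤ_[p]) : ℚ_[p]) (p / 2)
        else padicLFunctionMinusBranch f ((unitRoot V p : ℤ_[p]) : ℚ_[p]) (p / 2)))).valuation +
        2 * padicValNat p W.torsionOrder = padicValRat p s + padicValNat p W.tamagawaProduct := by
    rw [hX0eq, Padic.valuation_mul (coe_units_ne_zero p u) hϖB0, valuation_coe_units_eq_zero, zero_add,
      hdict]
  haveI : (Literature.NumberTheory.EllipticCurves.Module.charIdeal (IwasawaAlgebra p) D.X).IsPrincipal :=
    charIdeal_isPrincipal_holds p D.X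
  obtain ⟨fE, hchar⟩ := Submodule.IsPrincipal.principal
    (Literature.NumberTheory.EllipticCurves.Module.charIdeal (IwasawaAlgebra p) D.X)
  obtain ⟨hfin, ℓ, hℓp, hℓ1, hle, hiff⟩ := charIdeal_eq_span_iff_valuation_eq_rankZero_of_iota_eq hr0
    hBcl hκ hγ hγ' D hXt hchar hg hι hX0
  have hvg : (((PowerSeries.constantCoeff g : ℤ_[p]) : ℚ_[p])).valuation + 2 * padicValNat p W.torsionOrder =
      padicValRat p s + padicValNat p W.tamagawaProduct := by
    rw [← constantCoeff_iwasawaToPowerSeries p g, hι]; exact hvX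
  refine ⟨hXt, hfin, g, u, ℓ, hg, hι, hvg, hℓp, hℓ1, by linarith, ?_⟩
  rw [hiff]
  constructor <;> intro e <;> linarith

/-- **`BSD(E,p)` ⟹ THE MAIN CONJECTURE AT THE PAIR (integrally, E-normalised) AND `ℓ_p = 1`.** Same rows;
IF Miller's `BSD(E,p)` holds (`ord_p #Ш_an = ord_p #Ш[p^∞]`), then for every twist datum and cyclotomic
datum the Kato element `g` generates `char_Λ X(E/ℚ_∞)`, and every `(u', ℓ')` fitting clause 3 for `g` has `ℓ' = 1`
(anomalous or not). `BSD(E,p)` is a HYPOTHESIS; nothing booked. [cite: Kato2004Asterisque, Thm. 17.4 (3) (p. 273)]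
[cite: Delbourgo2002, Theorem (A), (B) (p. 40)] [cite: Miller2011LMS, Def. 1.1 (arXiv:1010.2431 p. 3)] -/
theorem ClassX4Gord.charIdeal_eq_span_kato_of_bsdp_rankZero
    (hK : Wuthrich2014.kato_halfEigenCharIdeal_dvd_cyclotomicPrime_of_surjective)
    (hDel : Delbourgo2002.mainTheorem) (hGZK : rank_eq_analyticRank_of_analyticRank_le_one)
    (hmod : hasEntireLFunction_rat)
    (hX : ClassX4Gord W p) (hp5 : 5 ≤ p) (hcm : ¬ W.HasCM) (hsurj : Surj W p)
    (hr : W.analyticRank = 0) (hBSD : BSDp W p)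
    (V : WeierstrassCurve ℚ) [V.IsElliptic] [V.IsGloballyMinimal] (C : VariableChange ℚ)
    (hC : C • V.quadraticTwist ((-1 : ℚ) ^ (p / 2) * p) = W) (hV : GoodOrd V p)
    {N : ℕ} [NeZero N] {f : CuspForm (Gamma0 N) 2} (hf : IsNewformOf V f)
    (ϖ : ℚ) (hϖ : if Even (p / 2) then (ϖ : ℝ) * V.realPeriodRat = plusPeriod f
      else (ϖ : ℝ) * V.imaginaryPeriodRat = minusPeriod f) :
    ∃ Dh : PAdicHeightData W p, LeadingTermClauses W p Dh ∧
      ∀ (κ : ZpExtension ℚ p) (γ : Field.absoluteGaloisGroup ℚ),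
        κ.IsCyclotomic → κ.IsTopGenerator γ → IsCyclotomicVariable p γ → ∀ D : W.SelmerDualData κ γ,
        ∃ (g : IwasawaAlgebra p) (u : ℤ_[p]ˣ), D.charIdeal = Ideal.span {g} ∧
          iwasawaToPowerSeries p g = PowerSeries.C (((u : ℤ_[p]) : ℚ_[p]) * (ϖ : ℚ_[p])) *
            (if Even (p / 2) then padicLFunctionBranch f ((unitRoot V p : ℤ_[p]) : ℚ_[p]) (p / 2)
              else padicLFunctionMinusBranch f ((unitRoot V p : ℤ_[p]) : ℚ_[p]) (p / 2)) ∧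
          ∀ (u' : ℤ_[p]ˣ) (ℓ' : ℕ), ℓ' ∣ p ^ 2 →
            ((PowerSeries.coeff W.mordellWeilRank g : ℤ_[p]) : ℚ_[p]) *
                padicLog p (cyclotomicGenerator p) ^ W.mordellWeilRank * (W.torsionOrder : ℚ_[p]) ^ 2 =
              ((u' : ℤ_[p]) : ℚ_[p]) * (ℓ' : ℚ_[p]) *
                ((Nat.card (AddCommGroup.primaryComponent W.sha p) : ℚ_[p]) *
                  padicRegulator Dh * W.tamagawaProduct) → ℓ' = 1 := by
  have hp2 : p ≠ 2 := by omega
  obtain ⟨hmw, -, s, hs, hsv⟩ := hBSD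
  have hr0 : W.mordellWeilRank = 0 := by rw [hmw, hr]
  obtain ⟨Dh, hBcl, hall⟩ := ClassX4Gord.padicVal_sha_add_le_shaAn_and_iff_rankZero hK hDel hGZK hmod hX hp5
    hcm hsurj hr hs V C hC hV hf ϖ hϖ
  refine ⟨Dh, hBcl, fun κ γ hκ hγ hγ' D ↦ ?_⟩
  obtain ⟨-, hfin, g, u, ℓ, -, hι, hvg, -, -, hle, hiff⟩ := hall κ γ hκ hγ hγ' D
  haveI := hfin
  haveI : Finite W.toAffine.Point := W.mordellWeilRank_eq_zero_iff_finite.mp hr0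
  have hℓ0 : (padicValNat p ℓ : ℤ) = 0 := by
    have h0 : (0 : ℤ) ≤ padicValNat p ℓ := by exact_mod_cast Nat.zero_le _
    rw [hsv] at hle; linarith
  refine ⟨g, u, hiff.mpr (by rw [hsv, hℓ0, add_zero]), hι, fun u' ℓ' hℓ'p heq ↦ ?_⟩
  -- clause 3 for `g`, valued: `v_p(g(0)) + 2t = ord_p ℓ' + ord_p #Ш[p^∞] + ord_p ∏c`; dictionary + BSD ⟹ `ord_p ℓ' = 0`
  have hℓ'0 : ℓ' ≠ 0 := by
    rintro rfl
    exact hp.out.ne_zero (pow_eq_zero_iff (n := 2) (by norm_num) |>.mp (zero_dvd_iff.mp hℓ'p))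
  have hReg1 : padicRegulator Dh = 1 := padicRegulator_eq_one_of_finite W p Dh
  have hS0 : Nat.card (AddCommGroup.primaryComponent W.sha p) ≠ 0 :=
    (Nat.card_pos (α := AddCommGroup.primaryComponent W.sha p)).ne'
  rw [hr0, PowerSeries.coeff_zero_eq_constantCoeff] at heq
  have hg0c : ((PowerSeries.constantCoeff g : ℤ_[p]) : ℚ_[p]) ≠ 0 := by
    intro e
    rw [e, zero_mul, zero_mul] at heq
    have hc : (W.tamagawaProduct : ℚ_[p]) ≠ 0 := by
      exact_mod_cast (W.tamagawaProduct_pos_holds : 0 < W.tamagawaProduct).ne'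
    refine (mul_ne_zero (mul_ne_zero (coe_units_ne_zero p u') (by exact_mod_cast hℓ'0))
      (mul_ne_zero (mul_ne_zero (by exact_mod_cast hS0) (by rw [hReg1]; exact one_ne_zero)) hc)) heq.symm
  have hval := TameBranchFullSqueeze.valuation_eq_of_clause_three (W := W) hp2 hg0c
    (by rw [hReg1]; exact one_ne_zero) hℓ'0 hS0 heq
  rw [hReg1, Padic.valuation_one] at hval
  simp only [Nat.cast_zero, add_zero] at hval
  have hℓ'v : (padicValNat p ℓ' : ℤ) = 0 := by
    have h0 : (0 : ℤ) ≤ padicValNat p ℓ' := by exact_mod_cast Nat.zero_le _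
    linarith
  exact TameBranchFullSqueeze.eq_one_of_dvd_prime_sq_of_padicValNat_eq_zero hℓ'p (by exact_mod_cast hℓ'v)

/-- **CONVERSELY, OFF THE ANOMALOUS ROWS: THE MAIN CONJECTURE AT THE PAIR ⟹ `BSD(E,p)`.** Same rows,
non-anomalous over the (G)-field (Delbourgo's `ℓ_p = 1`), `#Ш_an(E) ∈ ℚ`; twist data `(V, C, f, ϖ)`. IF
for every cyclotomic dual datum every Kato-shaped element (`g ∈ char_Λ X`, `ι g = u·ϖ·B^±`) generates
`char_Λ X(E/ℚ_∞)`, then Miller's `BSD(E,p)` holds. [cite: Kato2004Asterisque, Thm. 17.4 (3) (p. 273)]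
[cite: Delbourgo2002, Theorem (A), (B) (p. 40)] [cite: Miller2011LMS, Def. 1.1 (arXiv:1010.2431 p. 3)] -/
theorem ClassX4Gord.bsdp_of_charIdeal_eq_span_kato_rankZero
    (hK : Wuthrich2014.kato_halfEigenCharIdeal_dvd_cyclotomicPrime_of_surjective)
    (hDel : Delbourgo2002.mainTheorem) (hGZK : rank_eq_analyticRank_of_analyticRank_le_one)
    (hmod : hasEntireLFunction_rat)
    (hX : ClassX4Gord W p) (hp5 : 5 ≤ p) (hcm : ¬ W.HasCM) (hsurj : Surj W p)
    (hr : W.analyticRank = 0) (hna : ReductionNonAnomalous W p) {s : ℚ} (hs : shaAn W = (s : ℂ))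
    (V : WeierstrassCurve ℚ) [V.IsElliptic] [V.IsGloballyMinimal] (C : VariableChange ℚ)
    (hC : C • V.quadraticTwist ((-1 : ℚ) ^ (p / 2) * p) = W) (hV : GoodOrd V p)
    {N : ℕ} [NeZero N] {f : CuspForm (Gamma0 N) 2} (hf : IsNewformOf V f)
    (ϖ : ℚ) (hϖ : if Even (p / 2) then (ϖ : ℝ) * V.realPeriodRat = plusPeriod f
      else (ϖ : ℝ) * V.imaginaryPeriodRat = minusPeriod f)
    (hMC : ∀ (κ : ZpExtension ℚ p) (γ : Field.absoluteGaloisGroup ℚ),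
      κ.IsCyclotomic → κ.IsTopGenerator γ → IsCyclotomicVariable p γ → ∀ (D : W.SelmerDualData κ γ)
      (g : IwasawaAlgebra p) (u : ℤ_[p]ˣ), g ∈ D.charIdeal →
        iwasawaToPowerSeries p g = PowerSeries.C (((u : ℤ_[p]) : ℚ_[p]) * (ϖ : ℚ_[p])) *
          (if Even (p / 2) then padicLFunctionBranch f ((unitRoot V p : ℤ_[p]) : ℚ_[p]) (p / 2)
            else padicLFunctionMinusBranch f ((unitRoot V p : ℤ_[p]) : ℚ_[p]) (p / 2)) →
        D.charIdeal = Ideal.span {g}) :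
    BSDp W p := by
  obtain ⟨hmw, -⟩ := hGZK W (by rw [hr]; norm_num)
  obtain ⟨Dh, -, hall⟩ := ClassX4Gord.padicVal_sha_add_le_shaAn_and_iff_rankZero hK hDel hGZK hmod hX hp5
    hcm hsurj hr hs V C hC hV hf ϖ hϖ
  obtain ⟨κ₀, γ₀, hκ₀, hγ₀, hγ₀', D₀, -, -⟩ := exists_cyclotomic_dualData_generator W p
  obtain ⟨-, hfin, g, u, ℓ, hg, hι, -, -, hℓ1, -, hiff⟩ := hall κ₀ γ₀ hκ₀ hγ₀ hγ₀' D₀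
  have heq := hiff.mp (hMC κ₀ γ₀ hκ₀ hγ₀ hγ₀' D₀ g u hg hι)
  rw [hℓ1 hna, padicValNat_one_right, Nat.cast_zero, add_zero] at heq
  exact ⟨hmw, hfin, s, hs, heq.symm⟩

/-- **A LOWER BOUND ON `#Ш(E)[p^∞]` IS THE CERTIFICATE WHERE `p ∣ #Ш_an`.** Same rows; IF `ord_p #Ш_an(E) ≤ ord_p #Ш(E/ℚ)[p^∞]`
(the LOWER half at the pair — e.g. `p^{ord_p #Ш_an}` independent elements of `Ш(E)[p^∞]` exhibited by a `p`-descent / visibility;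
no Euler system supplies it), then the upper half WITH `ℓ` closes the chain: **`BSD(E,p)`**, and for every twist datum and
cyclotomic datum **the Kato element generates `char_Λ X(E/ℚ_∞)`** and Delbourgo's `ℓ = 1`. On the census's `25 ∣ #Ш_an` rows
(2900d1, 10850m1, 16900k1, 19350cb1 at `p = 5`) this is the exact residual. [cite: Kato2004Asterisque, Thm. 17.4 (3) (p. 273)]
[cite: Delbourgo2002, Theorem (A), (B) (p. 40)] [cite: Miller2011LMS, Def. 1.1 (arXiv:1010.2431 p. 3)] -/
theorem ClassX4Gord.bsdp_and_charIdeal_eq_span_kato_of_shaAn_le_card_rankZero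
    (hK : Wuthrich2014.kato_halfEigenCharIdeal_dvd_cyclotomicPrime_of_surjective)
    (hDel : Delbourgo2002.mainTheorem) (hGZK : rank_eq_analyticRank_of_analyticRank_le_one)
    (hmod : hasEntireLFunction_rat)
    (hX : ClassX4Gord W p) (hp5 : 5 ≤ p) (hcm : ¬ W.HasCM) (hsurj : Surj W p)
    (hr : W.analyticRank = 0) {s : ℚ} (hs : shaAn W = (s : ℂ))
    (hlow : padicValRat p s ≤ padicValNat p (Nat.card (AddCommGroup.primaryComponent W.sha p)))
    (V : WeierstrassCurve ℚ) [V.IsElliptic] [V.IsGloballyMinimal] (C : VariableChange ℚ)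
    (hC : C • V.quadraticTwist ((-1 : ℚ) ^ (p / 2) * p) = W) (hV : GoodOrd V p)
    {N : ℕ} [NeZero N] {f : CuspForm (Gamma0 N) 2} (hf : IsNewformOf V f)
    (ϖ : ℚ) (hϖ : if Even (p / 2) then (ϖ : ℝ) * V.realPeriodRat = plusPeriod f
      else (ϖ : ℝ) * V.imaginaryPeriodRat = minusPeriod f) :
    BSDp W p ∧ ∃ Dh : PAdicHeightData W p, LeadingTermClauses W p Dh ∧
      ∀ (κ : ZpExtension ℚ p) (γ : Field.absoluteGaloisGroup ℚ),
        κ.IsCyclotomic → κ.IsTopGenerator γ → IsCyclotomicVariable p γ → ∀ D : W.SelmerDualData κ γ,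
        ∃ (g : IwasawaAlgebra p) (u : ℤ_[p]ˣ) (ℓ : ℕ), D.charIdeal = Ideal.span {g} ∧
          iwasawaToPowerSeries p g = PowerSeries.C (((u : ℤ_[p]) : ℚ_[p]) * (ϖ : ℚ_[p])) *
            (if Even (p / 2) then padicLFunctionBranch f ((unitRoot V p : ℤ_[p]) : ℚ_[p]) (p / 2)
              else padicLFunctionMinusBranch f ((unitRoot V p : ℤ_[p]) : ℚ_[p]) (p / 2)) ∧
          ℓ ∣ p ^ 2 ∧ ℓ = 1 ∧
          (padicValNat p (Nat.card (AddCommGroup.primaryComponent W.sha p)) : ℤ) + padicValNat p ℓ =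
            padicValRat p s := by
  obtain ⟨hmw, -⟩ := hGZK W (by rw [hr]; norm_num)
  obtain ⟨Dh, hBcl, hall⟩ := ClassX4Gord.padicVal_sha_add_le_shaAn_and_iff_rankZero hK hDel hGZK hmod hX hp5
    hcm hsurj hr hs V C hC hV hf ϖ hϖ
  have key : ∀ (κ : ZpExtension ℚ p) (γ : Field.absoluteGaloisGroup ℚ),
      κ.IsCyclotomic → κ.IsTopGenerator γ → IsCyclotomicVariable p γ → ∀ D : W.SelmerDualData κ γ,
      Finite (AddCommGroup.primaryComponent W.sha p) ∧
        (padicValNat p (Nat.card (AddCommGroup.primaryComponent W.sha p)) : ℤ) = padicValRat p s ∧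
      ∃ (g : IwasawaAlgebra p) (u : ℤ_[p]ˣ) (ℓ : ℕ), D.charIdeal = Ideal.span {g} ∧
        iwasawaToPowerSeries p g = PowerSeries.C (((u : ℤ_[p]) : ℚ_[p]) * (ϖ : ℚ_[p])) *
          (if Even (p / 2) then padicLFunctionBranch f ((unitRoot V p : ℤ_[p]) : ℚ_[p]) (p / 2)
            else padicLFunctionMinusBranch f ((unitRoot V p : ℤ_[p]) : ℚ_[p]) (p / 2)) ∧
        ℓ ∣ p ^ 2 ∧ ℓ = 1 ∧
        (padicValNat p (Nat.card (AddCommGroup.primaryComponent W.sha p)) : ℤ) + padicValNat p ℓ =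
          padicValRat p s := by
    intro κ γ hκ hγ hγ' D
    obtain ⟨-, hfin, g, u, ℓ, -, hι, -, hℓp, -, hle, hiff⟩ := hall κ γ hκ hγ hγ' D
    have h0 : (0 : ℤ) ≤ padicValNat p ℓ := by exact_mod_cast Nat.zero_le _
    have hℓ0 : padicValNat p ℓ = 0 := by
      have : (padicValNat p ℓ : ℤ) ≤ 0 := by linarith
      omega
    have hle' : (padicValNat p (Nat.card (AddCommGroup.primaryComponent W.sha p)) : ℤ) ≤ padicValRat p s := by
      have h := hle; rw [hℓ0, Nat.cast_zero, add_zero] at h; exact h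
    have hcardeq : (padicValNat p (Nat.card (AddCommGroup.primaryComponent W.sha p)) : ℤ) = padicValRat p s :=
      le_antisymm hle' hlow
    have heq : (padicValNat p (Nat.card (AddCommGroup.primaryComponent W.sha p)) : ℤ) + padicValNat p ℓ =
        padicValRat p s := by rw [hℓ0, Nat.cast_zero, add_zero]; exact hcardeq
    exact ⟨hfin, hcardeq, g, u, ℓ, hiff.mpr heq, hι, hℓp,
      TameBranchFullSqueeze.eq_one_of_dvd_prime_sq_of_padicValNat_eq_zero hℓp hℓ0, heq⟩
  obtain ⟨κ₀, γ₀, hκ₀, hγ₀, hγ₀', D₀, -, -⟩ := exists_cyclotomic_dualData_generator W p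
  obtain ⟨hfin, hcard, -⟩ := key κ₀ γ₀ hκ₀ hγ₀ hγ₀' D₀
  exact ⟨⟨hmw, hfin, s, hs, hcard.symm⟩, Dh, hBcl, fun κ γ hκ hγ hγ' D ↦ (key κ γ hκ hγ hγ' D).2.2⟩

end ClassLevel

end Summit.BirchSwinnertonDyer.Rank1Residual.Additive

end
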